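import Literature.AlgebraicGeometry.AbelianSchemes.PoincareBaseQuotientDescentPicZero
import Literature.AlgebraicGeometry.AbelianSchemes.AbelianSchemeBaseQuotientHomDescent
import Literature.AlgebraicGeometry.AbelianSchemes.LevelStructureBaseQuotientDescent
import Literature.AlgebraicGeometry.AbelianSchemes.LevelStructureTransportIso
import Literature.AlgebraicGeometry.AbelianSchemes.IsLambdaOfAtOfIsBaseChangeVia
import Literature.AlgebraicGeometry.AbelianSchemes.AbelianSchemeSymplecticLevelTransfer
import Literature.AlgebraicGeometry.AbelianSchemes.PolarizedAbelianSchemeWithLevelBaseChange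
import Literature.AlgebraicGeometry.Morphisms.RelDimOfEtaleSurjectiveComp
import Literature.AlgebraicGeometry.RelativeSpec.GeometricQuotientFreeEtale
import HarnessLib

/-!
# Polarisation, type, level structure and symplectic liftability descend along a free finite quotient OF THE BASE
# — in the `IsBaseChangeVia` currency ([MFK94] Ch. 7 §3, remark after Thm. 7.9 and Lemma 7.11; [Lan13] Lemma 1.3.6.6; SGA 1 VIII 7.8)

Topic `AlgebraicGeometry/AbelianSchemes`; namespace `Literature.AlgebraicGeometry.AbelianSchemes.AbelianSchemeOver`.  THEOREMS ONLY (no definition,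
no named fact, no instance, no notation, no `sorry`; net Literature debt 0).  Cell hodgecm-mathlib (D-0151), F-DAG price
sheet leaf F-10 (10a) «the universal triple DESCENDS along the free finite quotient of the base `M → M/Γ`» — THE
JUNCTION, in the ★ `IsBaseChangeVia` currency the consumer holds: after ★ `AbelianSchemeBaseQuotientDescent` (the abelian
schemes `A`, `Â` descend to `B`, `B̂`), ★ `AbelianSchemeBaseQuotientHomDescent` (homomorphisms and sections), ★
`LevelStructureBaseQuotientDescent` (level structures), ★ `PoincareBaseQuotientDescent` + `…PicZero` + `DualPairBaseQuotientDescent{Unique,}`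
(the dual pair), this file descends the POLARISATION with its TYPE and the LEVEL STRUCTURE with its SYMPLECTIC LIFTABILITY, each
with the clause of ★ `PolarizedAbelianSchemeWithLevel.IsBaseChangeVia` it is responsible for (`λ ≫ π̂ = π ≫ λ_B`,
`σᵢ ≫ π = p ≫ ψ.σᵢ`); the sequel ★/HOME `PolarizedTripleBaseQuotientDescent` assembles the descended triple.  HC_CM is proved only modulo the 7 printed citations until rung 0 closes;
this file discharges none of them (count-neutral capital).

SETTING.  `p : S → Q` an affine geometric quotient by a FREE action `ρ` of the finite group `G` (surjective; for the
fibrewise clauses also locally of finite type, so that geometric points of `Q` LIFT to `S`, ★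
`Morphisms.exists_comp_eq_of_surjective`); `π : A → B`, `π̂ : Â → B̂` exhibiting `A`, `Â = D.hat` as base changes of `B`,
`B̂ = DB.hat` along `p` as group schemes (`hAB`, `hÂB̂`); actions `ρA`, `ρÂ` over `π`, `π̂`, `ρA` covering `ρ` (`hA`).

* §1 `IsBaseChangeVia.exists_iso_baseChange` (`A ≅ B ×_Q S` over `S`, compatibly with `π`), `IsBaseChangeVia.exists_fibreIso`
  (**the fibre isomorphisms `e_s : A_s ≅ B_{s ≫ p}` over `π`**), `map_restrictPt_eq_of_left_comp_eq` (`e_s(σ(s)) = τ(s ≫ p)`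
  for descended sections).
* §2 `Polarization.exists_desc_of_isBaseChangeVia` — an equivariant polarisation `λ` descends to `λ_B` with
  `λ ≫ π̂ = π ≫ λ_B` (★ `exists_isMonHom_desc_of_free_base_quotient`; ample witnesses by ★ `transfer_of_isBaseChangeVia_fibreIso`).
* §3 `Polarization.hasType_of_isBaseChangeVia` — the type descends (kernels of `λ̄`, `λ̄_B` on `Ω`-points correspond under
  `e_s`: ★ `valueAt_map_fibreIso_eq` and `Â = B̂ ×_Q S`).
* §4 `LevelStructure.exists_desc_of_isBaseChangeVia` — an equivariant level structure descends (★ `LevelStructure.exists_comp_of_iso`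
  along §1, then ★ `LevelStructure.exists_desc_of_free_base_quotient`).
* §5 `LevelStructure.isSymplecticLiftable_of_isBaseChangeVia` — symplectic liftability descends (★
  `IsLambdaOfAt.of_isBaseChangeVia_fibreIso`, ★ `SymplecticLift.nonempty_transport`, ★ `nonempty_of_linEquiv`).

Mathlib searched (pin): `MorphismProperty.IsStableUnderBaseChange.of_isPullback` (`Etale`, `Surjective`, `IsAffineHom`),
`SmoothOfRelativeDimension` of a composite, `IsPullback.hom_ext` (all used).

## References
* D. Mumford, J. Fogarty, F. Kirwan, *Geometric Invariant Theory*, 3rd ed. (1994), Ch. 6 §2 Definition 6.3 (p. 120); Ch. 7 §2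
  Definitions 7.1–7.2 (p. 129); §3, remark after Thm. 7.9 and Lemma 7.11 (pp. 139–140); App. 7A (pp. 234–235). [MumfordFogartyKirwan1994]
* A. Grothendieck, *SGA 1*, Exp. VIII Cor. 7.8. [SGA1]
* K.-W. Lan, *Arithmetic compactifications of PEL-type Shimura varieties* (2013), §1.3.6 Lemma 1.3.6.6, Cor. 1.3.6.7
  (pp. 81–82); Rem. 1.4.1.9 (p. 90). [Lan2013PELCompactifications]
* U. Görtz, T. Wedhorn, *Algebraic Geometry I*, 2nd ed. (2020), Section (4.7) (pp. 107–108), Prop. 4.16 (p. 101). [GortzWedhorn2020]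
-/

noncomputable section

universe u

open CategoryTheory Limits AlgebraicGeometry MonoidalCategory CartesianMonoidalCategory MonObj

namespace Literature.AlgebraicGeometry.AbelianSchemes.AbelianSchemeOver

open Literature.AlgebraicGeometry.RelativeSpec Literature.AlgebraicGeometry.RelativeSpec.ActionOver
  Literature.AlgebraicGeometry.Modules Literature.AlgebraicGeometry.Motives
  Literature.AlgebraicGeometry.AbelianVarieties Literature.AlgebraicGeometry.Morphisms

set_option backward.isDefEq.respectTransparency false

variable {S Q : Scheme.{u}} {p : S ⟶ Q} {A : AbelianSchemeOver S} {B : AbelianSchemeOver Q}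
  {π : A.X.left ⟶ B.X.left} (hAB : A.IsBaseChangeVia B p π)

include hAB

/-! ### §1 `A ≅ B ×_Q S` over `S` and the fibre isomorphisms `A_s ≅ B_{s ≫ p}` over `π` -/

/-- **`A ≅ B ×_Q S` as group schemes over `S`, compatibly with `π`** (both are base changes of `B` along `p`:
★ `exists_isBaseChangeVia_id`, ★ `exists_iso_of_isBaseChangeVia_id`). [cite: GortzWedhorn2020, Prop. 4.16 (p. 101)]
[cite: MumfordFogartyKirwan1994, Ch. 7 §2 Definition 7.2 (p. 129)] -/
theorem IsBaseChangeVia.exists_iso_baseChange :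
    ∃ E : A.X ≅ (B.baseChange p).X, IsMonHom E.hom ∧ E.hom.left ≫ pullback.fst B.X.hom p = π := by
  obtain ⟨H, _, hH, hid⟩ := IsBaseChangeVia.exists_isBaseChangeVia_id (B.baseChange_isBaseChangeVia p) hAB
  obtain ⟨E, hE, hEm⟩ := exists_iso_of_isBaseChangeVia_id hid
  exact ⟨E, hEm, by rw [hE, hH]⟩

/-- **The geometric fibres of a base change: `A_s ≅ B_{s ≫ p}` as abelian varieties, over `π`.**  For
`π : A → B` exhibiting `A` as the base change of `B` along `p` as group schemes and a field-valued point `s` of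
`S`, an isomorphism `e : A_s ≅ B_{s ≫ p}` of abelian varieties over `Ω` with `e ≫ pr_B = pr_A ≫ π` (through
`A ≅ B ×_Q S`, ★ `fibreIsoOfIso` and ★ `fibreBaseChangeIso`). [cite: GortzWedhorn2020, Section (4.7) (pp. 107–108) and Prop. 4.16 (p. 101)]
[cite: MumfordFogartyKirwan1994, Ch. 7 §2 Definition 7.2 (p. 129)] -/
theorem IsBaseChangeVia.exists_fibreIso {Ω : Type u} [Field Ω] (s : Spec (.of Ω) ⟶ S) :
    ∃ e : (A.fibre s).toAbelianVariety ≅ (B.fibre (s ≫ p)).toAbelianVariety,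
      AbelianVariety.Hom.toSchemeHom e.hom ≫ pullback.fst B.X.hom (s ≫ p) = pullback.fst A.X.hom s ≫ π := by
  obtain ⟨E, hEm, hE⟩ := hAB.exists_iso_baseChange
  haveI := hEm
  refine ⟨fibreIsoOfIso E s ≪≫ B.fibreBaseChangeIso p s, ?_⟩
  change (AbelianVariety.Hom.toSchemeHom (fibreIsoOfIso E s).hom ≫
    AbelianVariety.Hom.toSchemeHom (B.fibreBaseChangeIso p s).hom) ≫ _ = _
  rw [Category.assoc, B.fibreBaseChangeIso_hom_toSchemeHom_fst p s]
  change AbelianVariety.Hom.toSchemeHom (fibreIsoOfIso E s).hom ≫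
    pullback.fst (B.baseChange p).X.hom s ≫ pullback.fst B.X.hom p = _
  rw [← Category.assoc, fibreIsoOfIso_hom_toSchemeHom_fst E s, Category.assoc, hE]

omit hAB in
/-- **Descended sections on the fibres**: for sections `σ` of `A` and `τ` of `B` with `σ ≫ π = p ≫ τ` and ANY fibre
isomorphism `e : A_s ≅ B_{s ≫ p}` over `π`, `e(σ(s)) = τ(s ≫ p)` on `Ω`-points (the `he` input of ★
`SymplecticLift.nonempty_transport` / ★ `IsSymplecticLiftable.of_fibreIso`). [cite: MumfordFogartyKirwan1994, Ch. 7 §2 Definitions 7.1–7.2 (p. 129)] -/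
theorem map_restrictPt_eq_of_left_comp_eq {Ω : Type u} [Field Ω] (s : Spec (.of Ω) ⟶ S)
    (e : (A.fibre s).toAbelianVariety ≅ (B.fibre (s ≫ p)).toAbelianVariety)
    (he : AbelianVariety.Hom.toSchemeHom e.hom ≫ pullback.fst B.X.hom (s ≫ p) = pullback.fst A.X.hom s ≫ π)
    (σ : A.Sections) (τ : B.Sections) (hστ : σ.left ≫ π = p ≫ τ.left) :
    AlgPoints.map e.hom.hom.hom.hom (A.restrictPt s σ) = B.restrictPt (s ≫ p) τ := by
  have hsnd : AbelianVariety.Hom.toSchemeHom e.hom ≫ pullback.snd B.X.hom (s ≫ p) = pullback.snd A.X.hom s :=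
    Over.w e.hom.hom.hom.hom
  apply Over.OverMorphism.ext
  change (A.restrictPt s σ).left ≫ AbelianVariety.Hom.toSchemeHom e.hom = (B.restrictPt (s ≫ p) τ).left
  apply pullback.hom_ext
  · rw [Category.assoc, he, ← Category.assoc, A.restrictPt_left_fst, B.restrictPt_left_fst, Category.assoc, hστ,
      Category.assoc]
  · rw [Category.assoc, hsnd, A.restrictPt_left_snd, B.restrictPt_left_snd]

end Literature.AlgebraicGeometry.AbelianSchemes.AbelianSchemeOver

namespace Literature.AlgebraicGeometry.AbelianSchemes.AbelianSchemeOver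

open Literature.AlgebraicGeometry.RelativeSpec Literature.AlgebraicGeometry.RelativeSpec.ActionOver
  Literature.AlgebraicGeometry.Modules Literature.AlgebraicGeometry.Motives
  Literature.AlgebraicGeometry.AbelianVarieties Literature.AlgebraicGeometry.Morphisms

variable {S Q : Scheme.{u}} {p : S ⟶ Q} {G : Type u} [Group G] [Fintype G] {ρ : ActionOver p G}
  (hq : ρ.IsGeometricQuotient p) [IsAffineHom p]
  (hfree : ∀ (V : Q.Opens), IsAffineOpen V → ∀ g : G, g ≠ 1 →
    Ideal.span (Set.range fun s : Γ(S, p ⁻¹ᵁ V) ↦ ρ.act g V s - s) = ⊤)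
  {A : AbelianSchemeOver S} {B : AbelianSchemeOver Q} {π : A.X.left ⟶ B.X.left} (hAB : A.IsBaseChangeVia B p π)
  (ρA : ActionOver π G) (hA : ∀ g : G, (ρA.aut g).hom ≫ A.X.hom = A.X.hom ≫ (ρ.aut g).hom)
  (D : A.DualPair) (DB : B.DualPair) {πh : D.hat.X.left ⟶ DB.hat.X.left}
  (hABh : D.hat.IsBaseChangeVia DB.hat p πh) (ρh : ActionOver πh G)

/-! ### §2 The polarisation descends -/

include hq hfree hA in
/-- **AN EQUIVARIANT POLARISATION DESCENDS ALONG A FREE FINITE QUOTIENT OF THE BASE** (★ `IsBaseChangeVia` currency).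
In the SETTING (`p : S → Q` a free affine geometric quotient, locally of finite type; `π : A → B`, `π̂ : Â → B̂`
exhibiting `A`, `Â` as base changes of `B`, `B̂ = DB.hat` along `p`; `G` acting on `A`, `Â` over `π`, `π̂`, `ρA` covering
`ρ`; the Poincaré clause `(π ×_p π̂)^*𝒫_B ≅ 𝒫`): a polarisation `λ : A → Â` of `A` (w.r.t. `D`) with
`ρA(g) ≫ λ = λ ≫ ρÂ(g)` descends to a polarisation `λ_B : B → B̂` of `B` (w.r.t. `DB`) with `λ ≫ π̂ = π ≫ λ_B`:
`λ_B` is the descended homomorphism (★ `exists_isMonHom_desc_of_free_base_quotient`); at a geometric point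
`t = s ≫ p` of `Q` the ample witness of `λ` at `s` moves along `A_s ≅ B_t` (§1) by ★ `transfer_of_isBaseChangeVia_fibreIso`.
[cite: MumfordFogartyKirwan1994, Ch. 6 §2 Definition 6.3 (p. 120); Ch. 7 §3, remark after Thm. 7.9 and Lemma 7.11 (pp. 139–140)]
[cite: SGA1, Exp. VIII Cor. 7.8] -/
theorem Polarization.exists_desc_of_isBaseChangeVia [Surjective p] [LocallyOfFiniteType p] [DB.hat.X.left.IsSeparated]
    (pol : A.Polarization D)
    (eP : Nonempty ((Scheme.Modules.pullback
      (pullback.map A.X.hom D.hat.X.hom B.X.hom DB.hat.X.hom π πh p hAB.fst.symm hABh.fst.symm)).obj DB.P ≅ D.P))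
    (hlam : ∀ g : G, (ρA.aut g).hom ≫ pol.lam.left = pol.lam.left ≫ (ρh.aut g).hom) :
    ∃ polB : B.Polarization DB, pol.lam.left ≫ πh = π ≫ polB.lam.left := by
  haveI := pol.isMonHom
  haveI : IsAffineHom π := MorphismProperty.IsStableUnderBaseChange.of_isPullback hAB.snd.1.flip inferInstance
  have hπ : ρA.IsGeometricQuotient π := hq.isGeometricQuotient_baseChange_of_free hfree hAB.snd.1.flip ρA hA
  obtain ⟨lamB, hmon, hcomm⟩ := exists_isMonHom_desc_of_free_base_quotient hq hfree hAB hABh hπ ρh pol.lam hlam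
  obtain ⟨eP⟩ := eP
  refine ⟨{ lam := lamB, isMonHom := hmon, exists_ample := fun Ω _ _ t => ?_ }, hcomm⟩
  obtain ⟨s, rfl⟩ := exists_comp_eq_of_surjective p t
  obtain ⟨e, he⟩ := hAB.exists_fibreIso s
  obtain ⟨Θ, hΘ, hl⟩ := pol.exists_ample Ω s
  haveI : IsDominant (AbelianVariety.Hom.toSchemeHom e.inv) := AbelianVariety.isDominant_toSchemeHom_iso_hom e.symm
  exact ⟨_, transfer_of_isBaseChangeVia_fibreIso B DB lamB A D pol.lam p π πh hAB.fst.symm hABh.fst.symm hcomm s e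
    he eP Θ hΘ hl⟩

/-! ### §3 The type descends -/

include hAB hABh in
omit [Fintype G] [IsAffineHom p] in
/-- **THE TYPE CLAUSE DESCENDS** (★ `IsBaseChangeVia` currency): if `λ` has type `δ` then so has the descended `λ_B`
(`λ ≫ π̂ = π ≫ λ_B`).  At a geometric point `t = s ≫ p` the kernel of `λ̄` at `s` is carried onto the kernel of `λ̄_B` at
`t` by the group isomorphism `A_s(Ω) ≅ B_t(Ω)` of §1: `λ̄_B(e P) = λ̄(P) ≫ π̂` (★ `valueAt_map_fibreIso_eq`), and two points
of `Â = B̂ ×_Q S` over `s` with the same image in `B̂` coincide. [cite: MumfordFogartyKirwan1994, App. 7A (pp. 234–235)]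
[cite: Lan2013PELCompactifications, §1.3.6 Lemma 1.3.6.6 (pp. 81–82)] -/
theorem Polarization.hasType_of_isBaseChangeVia [Surjective p] [LocallyOfFiniteType p] (pol : A.Polarization D)
    (polB : B.Polarization DB) (hcomm : pol.lam.left ≫ πh = π ≫ polB.lam.left) {g₀ : ℕ} {δ : Fin g₀ → ℕ}
    (hT : pol.HasType δ) : polB.HasType δ := by
  refine ⟨hT.1, fun Ω _ _ t => ?_⟩
  obtain ⟨s, rfl⟩ := exists_comp_eq_of_surjective p t
  obtain ⟨e, he⟩ := hAB.exists_fibreIso s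
  obtain ⟨φ₀, hinj, hrange⟩ := hT.2 Ω s
  -- the group isomorphism on `Ω`-points induced by `e`
  let fwd : (A.fibre s).toAbelianVariety.Points Ω →* (B.fibre (s ≫ p)).toAbelianVariety.Points Ω :=
    IsMonHom.monoidHom e.hom.hom.hom.hom (specOver Ω Ω)
  let bwd : (B.fibre (s ≫ p)).toAbelianVariety.Points Ω →* (A.fibre s).toAbelianVariety.Points Ω :=
    IsMonHom.monoidHom e.inv.hom.hom.hom (specOver Ω Ω)
  have hfwd : ∀ P, fwd P = AlgPoints.map e.hom.hom.hom.hom P := fun P => rfl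
  have hfb : ∀ P, fwd (bwd P) = P := fun P => by
    change AlgPoints.map e.hom.hom.hom.hom (AlgPoints.map e.inv.hom.hom.hom P) = P
    rw [← AlgPoints.map_comp_apply]
    change AlgPoints.map (e.inv ≫ e.hom).hom.hom.hom P = P
    rw [e.inv_hom_id]
    exact AlgPoints.map_id_apply P
  have hbf : ∀ P, bwd (fwd P) = P := fun P => by
    change AlgPoints.map e.inv.hom.hom.hom (AlgPoints.map e.hom.hom.hom.hom P) = P
    rw [← AlgPoints.map_comp_apply]
    change AlgPoints.map (e.hom ≫ e.inv).hom.hom.hom P = P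
    rw [e.hom_inv_id]
    exact AlgPoints.map_id_apply P
  have hinj_fwd : Function.Injective fwd := Function.LeftInverse.injective hbf
  -- `λ̄_B(e P) = λ̄(P) ≫ π̂`
  have hval : ∀ P, polB.valueAt (s ≫ p) (fwd P) = pol.valueAt s P ≫ πh := fun P =>
    B.valueAt_map_fibreIso_eq DB polB.lam A D pol.lam p π πh hcomm s e he P
  have hker : ∀ P, fwd P ∈ polB.kerPointsAt (s ≫ p) ↔ P ∈ pol.kerPointsAt s := fun P => by
    rw [Polarization.mem_kerPointsAt_iff, Polarization.mem_kerPointsAt_iff, ← map_one fwd, hval, hval]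
    refine ⟨fun h => ?_, fun h => by rw [h]⟩
    -- two `Ω`-points of `Â = B̂ ×_Q S` over `s` with the same image in `B̂` agree
    exact hABh.snd.1.hom_ext h (by rw [Polarization.valueAt, Polarization.valueAt, valueAt_comp_hom, valueAt_comp_hom])
  refine ⟨fwd.comp φ₀, hinj_fwd.comp hinj, ?_⟩
  ext P
  constructor
  · rintro ⟨x, rfl⟩
    exact (hker (φ₀ x)).2 (hrange ▸ Set.mem_range_self x)
  · intro hP
    have hP' : bwd P ∈ pol.kerPointsAt s := (hker (bwd P)).1 (by rw [hfb]; exact hP)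
    rw [← hrange] at hP'
    obtain ⟨x, hx⟩ := hP'
    exact ⟨x, by rw [MonoidHom.comp_apply, hx, hfb]⟩

/-! ### §4 The level structure descends -/

include hq hfree hAB hA in
omit [IsAffineHom p] in
/-- **AN EQUIVARIANT LEVEL STRUCTURE DESCENDS** (★ `IsBaseChangeVia` currency): a level-`n` structure `φ` on `A` whose
sections satisfy `ρ(g) ≫ σᵢ = σᵢ ≫ ρA(g)` descends to a level-`n` structure `ψ` on `B` with `σᵢ ≫ π = p ≫ ψ.σᵢ` — the
level clause of ★ `LevelStructure.IsBaseChangeVia`.  (Transport `φ` along `A ≅ B ×_Q S` by ★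
`LevelStructure.exists_comp_of_iso`; there the sections are equivariant for `𝟙 ×_Q ρ(g)`, so ★
`LevelStructure.exists_desc_of_free_base_quotient` applies.) [cite: MumfordFogartyKirwan1994, Ch. 7 §2 Definitions 7.1–7.2 (p. 129) and §3 Lemma 7.11 (p. 140)]
[cite: SGA1, Exp. VIII Cor. 7.8] -/
theorem LevelStructure.exists_desc_of_isBaseChangeVia [IsAffineHom p] [B.X.left.IsSeparated] {g₀ n : ℕ}
    (φ : LevelStructure g₀ n A) (hφ : ∀ (g : G) (i : Fin g₀ ⊕ Fin g₀),
      (ρ.aut g).hom ≫ (φ.σ i).left = (φ.σ i).left ≫ (ρA.aut g).hom) :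
    ∃ ψ : LevelStructure g₀ n B, ∀ i, (φ.σ i).left ≫ π = p ≫ (ψ.σ i).left := by
  obtain ⟨E, hEm, hE⟩ := hAB.exists_iso_baseChange
  haveI := hEm
  obtain ⟨φ', hφ'⟩ := LevelStructure.exists_comp_of_iso E φ
  have hEsnd : E.hom.left ≫ pullback.snd B.X.hom p = A.X.hom := Over.w E.hom
  -- `E` intertwines `ρA(g)` with `𝟙 ×_Q ρ(g)`
  have hEq : ∀ g : G, (ρA.aut g).hom ≫ E.hom.left =
      E.hom.left ≫ pullback.map B.X.hom p B.X.hom p (𝟙 B.X.left) (ρ.aut g).hom (𝟙 Q)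
        (by rw [Category.id_comp, Category.comp_id]) (by rw [ρ.aut_comp, Category.comp_id]) := fun g => by
    have h1 : ((ρA.aut g).hom ≫ E.hom.left) ≫ pullback.fst B.X.hom p = π :=
      (Category.assoc _ _ _).trans (((ρA.aut g).hom ≫= hE).trans (ρA.aut_comp g))
    have h2 : ((ρA.aut g).hom ≫ E.hom.left) ≫ pullback.snd B.X.hom p = A.X.hom ≫ (ρ.aut g).hom :=
      (Category.assoc _ _ _).trans (((ρA.aut g).hom ≫= hEsnd).trans (hA g))
    have h3 : (E.hom.left ≫ pullback.map B.X.hom p B.X.hom p (𝟙 B.X.left) (ρ.aut g).hom (𝟙 Q)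
        (by rw [Category.id_comp, Category.comp_id]) (by rw [ρ.aut_comp, Category.comp_id])) ≫
        pullback.fst B.X.hom p = π :=
      (Category.assoc _ _ _).trans ((E.hom.left ≫= pullback.lift_fst _ _ _).trans
        ((E.hom.left ≫= Category.comp_id _).trans hE))
    have h4 : (E.hom.left ≫ pullback.map B.X.hom p B.X.hom p (𝟙 B.X.left) (ρ.aut g).hom (𝟙 Q)
        (by rw [Category.id_comp, Category.comp_id]) (by rw [ρ.aut_comp, Category.comp_id])) ≫
        pullback.snd B.X.hom p = A.X.hom ≫ (ρ.aut g).hom :=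
      (Category.assoc _ _ _).trans ((E.hom.left ≫= pullback.lift_snd _ _ _).trans
        ((Category.assoc _ _ _).symm.trans (hEsnd =≫ (ρ.aut g).hom)))
    apply pullback.hom_ext
    · exact h1.trans h3.symm
    · exact h2.trans h4.symm
  have hφ'eq : ∀ (g : G) (i : Fin g₀ ⊕ Fin g₀), (ρ.aut g).hom ≫ (φ'.σ i).left =
      (φ'.σ i).left ≫ pullback.map B.X.hom p B.X.hom p (𝟙 B.X.left) (ρ.aut g).hom (𝟙 Q)
        (by rw [Category.id_comp, Category.comp_id]) (by rw [ρ.aut_comp, Category.comp_id]) := fun g i => by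
    rw [hφ' i, Over.comp_left]
    exact ((Category.assoc _ _ _).symm.trans (((hφ g i) =≫ E.hom.left).trans
      ((Category.assoc _ _ _).trans (((φ.σ i).left ≫= hEq g).trans (Category.assoc _ _ _).symm))))
  obtain ⟨ψ, hψ⟩ := LevelStructure.exists_desc_of_free_base_quotient hq hfree B φ' hφ'eq
  refine ⟨ψ, fun i => ?_⟩
  rw [← hE, ← Category.assoc, ← Over.comp_left, ← hφ' i, ← hψ i, sectionBaseChange_left_comp_fst]

/-! ### §5 Symplectic-liftability descends -/

include hAB hABh in
omit [Fintype G] [IsAffineHom p] in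
/-- **THE SYMPLECTIC-LIFTABILITY CLAUSE DESCENDS** (★ `IsBaseChangeVia` currency): with `σᵢ ≫ π = p ≫ ψ.σᵢ`,
`λ ≫ π̂ = π ≫ λ_B` and the Poincaré clause, if `φ` is symplectic-liftable of type `δ` for `λ` then `ψ` is for `λ_B`.  At
`t = s ≫ p` with an ample witness `Θ_B` of `λ̄_B`: `e^*Θ_B` is an ample witness of `λ̄` at `s` (★
`IsLambdaOfAt.of_isBaseChangeVia_fibreIso`), lift there, and transport the lift along `e⁻¹` (★
`SymplecticLift.nonempty_transport`; `(e⁻¹)^*e^*Θ_B ∼ Θ_B`, ★ `SymplecticLift.nonempty_of_linEquiv`).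
[cite: Lan2013PELCompactifications, §1.3.6 Lemma 1.3.6.6 and Cor. 1.3.6.7 (pp. 81–82)]
[cite: MumfordFogartyKirwan1994, Ch. 7 §2 Definition 7.2 (p. 129)] -/
theorem LevelStructure.isSymplecticLiftable_of_isBaseChangeVia [Surjective p] [LocallyOfFiniteType p] {g₀ N : ℕ}
    (φ : LevelStructure g₀ N A) (ψ : LevelStructure g₀ N B) (hφψ : ∀ i, (φ.σ i).left ≫ π = p ≫ (ψ.σ i).left)
    (pol : A.Polarization D) (polB : B.Polarization DB) (hcomm : pol.lam.left ≫ πh = π ≫ polB.lam.left)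
    (eP : Nonempty ((Scheme.Modules.pullback
      (pullback.map A.X.hom D.hat.X.hom B.X.hom DB.hat.X.hom π πh p hAB.fst.symm hABh.fst.symm)).obj DB.P ≅ D.P))
    (δ : Fin g₀ → ℕ) (h : φ.IsSymplecticLiftable pol δ) : ψ.IsSymplecticLiftable polB δ := by
  intro Ω _ _ t ΘB hΘB hlamB
  obtain ⟨s, rfl⟩ := exists_comp_eq_of_surjective p t
  obtain ⟨e, he⟩ := hAB.exists_fibreIso s
  obtain ⟨eP⟩ := eP
  haveI := AbelianVariety.isDominant_toSchemeHom_iso_hom e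
  haveI := AbelianVariety.isDominant_toSchemeHom_iso_hom e.symm
  have hhi : AbelianVariety.Hom.toSchemeHom e.hom ≫ AbelianVariety.Hom.toSchemeHom e.inv = 𝟙 _ := by
    change AbelianVariety.Hom.toSchemeHom (e.hom ≫ e.inv) = _
    rw [e.hom_inv_id]
    rfl
  have hih : AbelianVariety.Hom.toSchemeHom e.inv ≫ AbelianVariety.Hom.toSchemeHom e.hom = 𝟙 _ := by
    change AbelianVariety.Hom.toSchemeHom (e.inv ≫ e.hom) = _
    rw [e.inv_hom_id]
    rfl
  haveI : IsIso (AbelianVariety.Hom.toSchemeHom e.hom) := ⟨AbelianVariety.Hom.toSchemeHom e.inv, hhi, hih⟩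
  haveI : IsIso (AbelianVariety.Hom.toSchemeHom e.inv) := ⟨AbelianVariety.Hom.toSchemeHom e.hom, hih, hhi⟩
  haveI : IsDominant (AbelianVariety.Hom.toSchemeHom e.inv) := AbelianVariety.isDominant_toSchemeHom_iso_hom e.symm
  -- the witness moved to `A_s`
  have hΘ : (ΘB.pullback (AbelianVariety.Hom.toSchemeHom e.hom)).IsAmple := hΘB.pullback _
  have hlam : A.IsLambdaOfAt s D pol.lam (ΘB.pullback (AbelianVariety.Hom.toSchemeHom e.hom)) :=
    IsLambdaOfAt.of_isBaseChangeVia_fibreIso B DB polB.lam A D pol.lam p π πh hAB.fst.symm hABh.fst.symm hcomm s e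
      he eP ΘB hlamB
  obtain ⟨Λ⟩ := h Ω s _ hΘ hlam
  -- transport the lift along `e⁻¹`
  have he' : ∀ i, AlgPoints.map e.symm.hom.hom.hom.hom (B.restrictPt (s ≫ p) (ψ.σ i)) = A.restrictPt s (φ.σ i) :=
    fun i => by
    rw [← map_restrictPt_eq_of_left_comp_eq s e he (φ.σ i) (ψ.σ i) (hφψ i), ← AlgPoints.map_comp_apply]
    change AlgPoints.map (e.hom ≫ e.inv).hom.hom.hom _ = _
    rw [e.hom_inv_id]
    exact AlgPoints.map_id_apply _
  obtain ⟨Λ'⟩ := Λ.nonempty_transport (φ' := ψ) e.symm he'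
  have hsame : ((ΘB.pullback (AbelianVariety.Hom.toSchemeHom e.hom)).pullback
      (AbelianVariety.Hom.toSchemeHom e.symm.hom)).SameDivisor ΘB :=
    ((ΘB.pullback_pullback_sameDivisor _ _).trans (ΘB.pullback_congr_sameDivisor hih)).trans
      ΘB.pullback_id_sameDivisor
  exact Λ'.nonempty_of_linEquiv hsame.linEquiv


end Literature.AlgebraicGeometry.AbelianSchemes.AbelianSchemeOver

end
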